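import Literature.AlgebraicGeometry.Motives.EllAdicBockstein
import HarnessLib

/-!
# `Hⁱ_proét(Y, ℤ_ℓ)` is a finitely generated `ℤ_ℓ`-module for proper `Y`: reduction to two facts

The module-level finiteness statement for proper schemes — for `K` separably closed,
`Y → Spec K` proper, `ℓ` prime and every `i`, Mathlib's pro-étale group
`Hⁱ_proét(Y, ℤ_ℓ) = Scheme.EllAdicCohomology Y ℓ i` admits a finitely generated `ℤ_ℓ`-module
structure (Milne V Lemma 1.11 with VI Cor. 2.8; a composite, hence stated as the explicit
conclusion of proved reductions and not as a named fact, D-0026) — is proved here from the two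
remaining named facts of the `ℓ`-adic finiteness cluster,

* `finite_etaleCohomology_of_isProper` — Milne VI Cor. 2.8 (finiteness of `Hⁱ(Y_ét, M)` for
  `Y` proper over a separably closed field, `M` finite), and
* `ellAdicCohomology_limOneSequence` — Bhatt–Scholze Prop. 5.6.2 (the `lim¹` sequences
  `0 → lim¹_m Hʲ(Y_ét, ℤ/ℓᵐ) → Hʲ⁺¹_proét(Y, ℤ_ℓ) → lim_m Hʲ⁺¹(Y_ét, ℤ/ℓᵐ) → 0`),

Milne V Lemma 1.11 having been proved (`exists_module_finite_towerLim_etaleCohomology_holds`,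
`EllAdicBockstein.lean`):
`exists_module_finite_ellAdicCohomology_of_isProper_of_finiteness_of_comparison`.
In degree `0` no fact is needed: `H⁰_proét(Y, ℤ_ℓ) ≃+ C(Y, ℤ_ℓ)` (`ellAdicCohomologyZeroEquiv`)
and `C(Y, ℤ_ℓ)` is a finitely generated (free) `ℤ_ℓ`-module for the Noetherian space `Y`
(`module_finite_continuousMap_of_noetherianSpace`: it embeds `ℤ_ℓ`-linearly into the finite
product of copies of `ℤ_ℓ` indexed by the irreducible components, on each of which a continuous
map to the totally disconnected `ℤ_ℓ` is constant). In degrees `j + 1`: all `Hʳ(Y_ét, ℤ/ℓᵐ)` are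
finite, so `lim¹ = 0` (Mittag-Leffler, `subsingleton_towerLimOne_of_finite`), the 5.6.2 sequence
identifies `Hʲ⁺¹_proét(Y, ℤ_ℓ)` with `lim_m Hʲ⁺¹(Y_ét, ℤ/ℓᵐ)`, whose canonical `ℤ_ℓ`-module
structure is finitely generated (V.1.11), and a module structure is transported along the
additive isomorphism (`exists_module_finite_of_addEquiv`).

## References

* J. S. Milne, *Étale cohomology* (2025 reissue), V Lemma 1.11 (p. 177), VI Cor. 2.8 (p. 238).
  [Milne2025]
* B. Bhatt, P. Scholze, *The pro-étale topology for schemes*, Astérisque 369 (2015), Prop. 5.6.2,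
  Lemma 4.2.12, Def. 6.8.1. [BhattScholze2015]
-/

noncomputable section

universe u v w

open CategoryTheory AlgebraicGeometry TopologicalSpace

namespace Literature.AlgebraicGeometry.Motives

/-- Transport of a finitely generated module structure along an additive isomorphism: if
`M ≃+ N` and `N` is a finitely generated `R`-module, then `M` admits a finitely generated
`R`-module structure (compatible with its addition). [folklore] -/
theorem exists_module_finite_of_addEquiv {R : Type*} [Ring R] {M : Type v} {N : Type w}
    [AddCommGroup M] [AddCommGroup N] [Module R N] [Module.Finite R N] (e : M ≃+ N) :
    ∃ _ : Module R M, Module.Finite R M := by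
  letI : SMul R M := ⟨fun c x => e.symm (c • e x)⟩
  have hsmul : ∀ (c : R) (x : M), e (c • x) = c • e x := fun c x => e.apply_symm_apply _
  letI : Module R M := Function.Injective.module R e.toAddMonoidHom e.injective hsmul
  let e' : M ≃ₗ[R] N := { e with map_smul' := hsmul }
  exact ⟨inferInstance, Module.Finite.equiv e'.symm⟩

/-- For a Noetherian topological space `Y` and a prime `ℓ`, the `ℤ_ℓ`-module `C(Y, ℤ_ℓ)` of
continuous maps is finitely generated: evaluation at a point of each of the finitely many
irreducible components is an injective `ℤ_ℓ`-linear map to a finite free module (a continuous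
map to the totally disconnected `ℤ_ℓ` is constant on each irreducible component, and these
cover `Y`), and `ℤ_ℓ` is Noetherian. [folklore] -/
theorem module_finite_continuousMap_of_noetherianSpace (Y : Type v) [TopologicalSpace Y]
    [NoetherianSpace Y] (ℓ : ℕ) [Fact ℓ.Prime] : Module.Finite ℤ_[ℓ] C(Y, ℤ_[ℓ]) := by
  haveI := (NoetherianSpace.finite_irreducibleComponents (α := Y)).to_subtype
  have hne : ∀ Z : irreducibleComponents Y, (Z : Set Y).Nonempty := fun Z => Z.2.1.nonempty
  let φ : C(Y, ℤ_[ℓ]) →ₗ[ℤ_[ℓ]] (irreducibleComponents Y → ℤ_[ℓ]) :=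
    { toFun := fun g Z => g (hne Z).some
      map_add' := fun g h => rfl
      map_smul' := fun c g => rfl }
  refine Module.Finite.of_injective φ fun g h hgh => ?_
  ext y
  have hZ : irreducibleComponent y ∈ irreducibleComponents Y :=
    irreducibleComponent_mem_irreducibleComponents y
  have key : ∀ g : C(Y, ℤ_[ℓ]), g y = g (hne ⟨irreducibleComponent y, hZ⟩).some := fun g =>
    ((isIrreducible_irreducibleComponent (x := y)).isPreirreducible.isPreconnected.image g
      g.continuous.continuousOn).subsingleton
      ⟨y, mem_irreducibleComponent, rfl⟩ ⟨_, (hne ⟨irreducibleComponent y, hZ⟩).some_mem, rfl⟩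
  rw [key g, key h]
  exact congr_fun hgh ⟨irreducibleComponent y, hZ⟩

/-- **`H⁰_proét(Y, ℤ_ℓ)` of a Noetherian scheme is a finitely generated `ℤ_ℓ`-module**
(unconditionally): it is `C(Y, ℤ_ℓ)` (`ellAdicCohomologyZeroEquiv`, Bhatt–Scholze Lemma 4.2.12 and
Def. 6.8.1). [cite: BhattScholze2015, Lemma 4.2.12 and Def. 6.8.1] -/
theorem exists_module_finite_ellAdicCohomology_zero (Y : Scheme.{u}) [IsNoetherian Y] (ℓ : ℕ)
    [Fact ℓ.Prime] :
    ∃ _ : Module ℤ_[ℓ] (Y.EllAdicCohomology ℓ 0), Module.Finite ℤ_[ℓ] (Y.EllAdicCohomology ℓ 0) :=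
  haveI := module_finite_continuousMap_of_noetherianSpace Y ℓ
  exists_module_finite_of_addEquiv (ellAdicCohomologyZeroEquiv Y ℓ)

/-- **`Hʲ⁺¹_proét(Y, ℤ_ℓ)` is a finitely generated `ℤ_ℓ`-module for `Y` proper over a separably
closed field**, from Milne VI Cor. 2.8 and Bhatt–Scholze Prop. 5.6.2: all `Hʳ(Y_ét, ℤ/ℓᵐ)` are
finite, so `lim¹_m Hʲ(Y_ét, ℤ/ℓᵐ) = 0` and `Hʲ⁺¹_proét(Y, ℤ_ℓ) ≅ lim_m Hʲ⁺¹(Y_ét, ℤ/ℓᵐ)`, a finitely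
generated `ℤ_ℓ`-module by the proved Milne V Lemma 1.11 (`module_finite_towerLim_etaleCohomology`);
the structure is transported along the isomorphism.
[cite: Milne2025, V Lemma 1.11 and VI Cor. 2.8] [cite: BhattScholze2015, Prop. 5.6.2] -/
theorem exists_module_finite_ellAdicCohomology_succ_of_finiteness_of_comparison
    (h₂ : finite_etaleCohomology_of_isProper.{u}) (h₃ : ellAdicCohomology_limOneSequence.{u})
    {K : Type u} [Field K] [IsSepClosed K] {Y : Scheme.{u}} (f : Y ⟶ Spec (CommRingCat.of K))
    [IsProper f] (ℓ : ℕ) [Fact ℓ.Prime] (j : ℕ) :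
    ∃ _ : Module ℤ_[ℓ] (Y.EllAdicCohomology ℓ (j + 1)),
      Module.Finite ℤ_[ℓ] (Y.EllAdicCohomology ℓ (j + 1)) := by
  have hfin : ∀ i m : ℕ, Finite (etaleCohomologyZModPow Y ℓ i m) := fun i m =>
    haveI := finite_zmodPowAb.{u} ℓ m (Fact.out : ℓ.Prime).ne_zero
    h₂ K Y f (zmodPowAb ℓ m) i
  obtain ⟨δ, ρ, -, hρ, hδρ⟩ := h₃ Y ℓ j
  haveI : ∀ m, Finite (etaleCohomologyZModPow Y ℓ j m) := fun m => hfin j m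
  haveI := subsingleton_towerLimOne_of_finite (etaleCohomologyZModPowMap Y ℓ j)
  have hinj : Function.Injective ρ := by
    refine (injective_iff_map_eq_zero ρ).2 fun x hx => ?_
    have hx' : x ∈ ρ.ker := (AddMonoidHom.mem_ker).2 hx
    rw [← hδρ] at hx'
    obtain ⟨l, rfl⟩ := hx'
    rw [Subsingleton.elim l 0, map_zero]
  obtain ⟨inst, hfg⟩ := module_finite_towerLim_etaleCohomology Y ℓ (j + 1) (hfin (j + 1))
  exact exists_module_finite_of_addEquiv (AddEquiv.ofBijective ρ ⟨hinj, hρ⟩)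

/-- **`Hⁱ_proét(Y, ℤ_ℓ)` is a finitely generated `ℤ_ℓ`-module for `Y` proper over a separably
closed field, from Milne VI Cor. 2.8 and Bhatt–Scholze Prop. 5.6.2**: for `K` separably closed,
`Y → Spec K` proper, every prime `ℓ` and every `i`, `Hⁱ_proét(Y, ℤ_ℓ)` admits a finitely
generated `ℤ_ℓ`-module structure — degree `0` unconditionally (`Y` is Noetherian), degrees
`j + 1` by `exists_module_finite_ellAdicCohomology_succ_of_finiteness_of_comparison`. (The
conclusion is spelled out: it is Milne V Lemma 1.11 combined with VI Cor. 2.8 and the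
comparison, not a single printed theorem, so it is not a named fact; D-0026.) Combined with
`exists_addEquiv_geometricEllAdicCohomology_of_module_finite` (part I) this is a second route to
`exists_addEquiv_geometricEllAdicCohomology` from the same two facts.
[cite: Milne2025, V Lemma 1.11 and VI Cor. 2.8] [cite: BhattScholze2015, Prop. 5.6.2] -/
theorem exists_module_finite_ellAdicCohomology_of_isProper_of_finiteness_of_comparison
    (h₂ : finite_etaleCohomology_of_isProper.{u}) (h₃ : ellAdicCohomology_limOneSequence.{u})
    ⦃K : Type u⦄ [Field K] [IsSepClosed K] ⦃Y : Scheme.{u}⦄ (f : Y ⟶ Spec (CommRingCat.of K))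
    [IsProper f] (ℓ : ℕ) [Fact ℓ.Prime] (i : ℕ) :
    ∃ _ : Module ℤ_[ℓ] (Y.EllAdicCohomology ℓ i),
      Module.Finite ℤ_[ℓ] (Y.EllAdicCohomology ℓ i) := by
  cases i with
  | zero =>
    haveI : IsLocallyNoetherian Y := LocallyOfFiniteType.isLocallyNoetherian f
    haveI : CompactSpace Y := QuasiCompact.compactSpace_of_compactSpace f
    haveI : IsNoetherian Y := {}
    exact exists_module_finite_ellAdicCohomology_zero Y ℓ
  | succ j =>
    exact exists_module_finite_ellAdicCohomology_succ_of_finiteness_of_comparison h₂ h₃ f ℓ j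

end Literature.AlgebraicGeometry.Motives

end
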